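import Literature.AlgebraicTopology.FundamentalGroup.PunctureRank
import Literature.AlgebraicTopology.FundamentalGroup.PuncturedCompactRiemannSurfaceFreePi1Holds
import Literature.Topology.CoveringSpaces.CoveringMonodromyStabilizer
import Literature.GroupTheory.CombinatorialGroupTheory.SchreierIndexFormula
import Literature.Geometry.Kaehler.RiemannSurfaceRiemannRochSecondForm
import HarnessLib

/-!
# The fundamental group of a compact Riemann surface of genus `g` with `r ≥ 1` punctures is free of
# rank `2g + r − 1` (Massey Ch. 4 §5)

Topic `Literature/AlgebraicTopology/FundamentalGroup`; sequel of `PuncturedCompactRiemannSurfaceFreePi1Holds`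
(freeness of FINITE rank, by the analytic route: branched cover of the sphere, monodromy, Nielsen–Schreier)
and `PunctureRank` (each further puncture adds one to the rank).  W. S. Massey, *Algebraic Topology: An
Introduction* (1967), Ch. 4 §5: a compact connected orientable surface of genus `g` with `r ≥ 1` points
removed deformation retracts onto a wedge of `2g + r − 1` circles, so

> its fundamental group is free of rank `2g + r − 1`

[cite: Massey1967AlgebraicTopology, Ch. 4 §5].  Here `g` is the ARITHMETIC genus `arithGenus M = dim H¹(0) =
dim Ω¹(M)` of the compact Riemann surface (Miranda VI §3 (3.10)); the file thereby supplies the rank that the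
named fact `PuncturedCompactRiemannSurfaceFreePi1` left as `TODO(general form)` («the tree has no notion of
genus»), and it is the topological input for `rank π₁(M) = 2g` / `b₁(M) = 2g` (Farkas–Kra I.2.5; Hatcher §1.2
Cor. 1.27) in the sequel.

PROOF (analytic route; no triangulation / CW structure / classification of surfaces).  The RANKS are carried
through the proof of `PuncturedCompactRiemannSurfaceFreePi1Holds`:
* §1 a connected covering space `E → X` with fibre of cardinality `d` over a space with `π₁(X) ≅ F_n` has
  `π₁(E) ≅ F_r` with `r + d = d·n + 1` — the image `p_* π₁(E)` has index `d` (number of sheets = index of the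
  stabiliser, `CoverMonodromy.index_range_mapOfEq_eq_natCard_fiber`) and the SCHREIER INDEX FORMULA
  (`FreeGroup.exists_freeGroupBasis_of_finiteIndex`, Lyndon–Schupp I.3.9) gives the rank;
* §2 `π₁((ℂ ∪ {∞}) ∖ B) ≅ F_b` with `b + 1 = |B|` for `B ∋ ∞` finite (`(ℂ ∪ {∞}) ∖ B ≅ ℂ ∖ B'`, `|B'| = |B| − 1`,
  Hatcher Example 1.22 = the tree's `nonempty_mulEquiv_freeGroup_compl_finite`);
* §3 for a non-constant holomorphic `F : M → ℂ ∪ {∞}` of degree `m` and `B ⊇ {branch values} ∪ {∞}` finite,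
  `M ∖ F⁻¹(B)` is an `m`-sheeted connected covering of `(ℂ ∪ {∞}) ∖ B`, so `π₁(M ∖ F⁻¹(B)) ≅ F_r`,
  `r + m = m·b + 1`; counting the fibres over `B` with multiplicity, `|F⁻¹(B)| + deg R_F = m·|B|`
  (`Σ_{P ∈ F⁻¹(Q)} mult_P(F) = m`, Farkas–Kra I.1.6), and HURWITZ'S FORMULA `2g − 2 = deg R_F − 2m`
  (`two_mul_arithGenus_sub_two_eq_degree_ramificationDiv_sub`) turn this into **`r + 1 = 2g + |F⁻¹(B)|`**;
* §4 puncture independence with ranks (`PunctureRank`) moves from `F⁻¹(B)` to an arbitrary finite non-empty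
  `S`: **`π₁(M ∖ S, x) ≅ F_{2g + |S| − 1}`** (`nonempty_mulEquiv_freeGroup_compl_of_finite`), with the
  corollaries `π₁(M ∖ {p}) ≅ F_{2g}` and the `HasFreePiRank` form.

Everything is proved; no definitions, no instances, no named facts.

## References
* W. S. Massey, *Algebraic Topology: An Introduction*, GTM 56 (1967/1977), Ch. 4 §5.
  [Massey1967AlgebraicTopology]
* A. Hatcher, *Algebraic Topology*, CUP (2002), §1.2 Example 1.22, §1.3 Props. 1.31–1.32, §1.A Thm. 1A.4.
  [HatcherAT2002]
* R. C. Lyndon, P. E. Schupp, *Combinatorial Group Theory*, Ch. I Prop. 3.9 (Schreier index formula).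
  [LyndonSchupp2001]
* H. M. Farkas, I. Kra, *Riemann Surfaces*, GTM 71, 2nd ed. (1992), §I.1.6 (degree, branch points), §I.2.5
  (`π₁` and `H₁` of a compact surface of genus `g`). [FarkasKra1992]
* R. Miranda, *Algebraic Curves and Riemann Surfaces*, GSM 5 (1995), Chapter II Theorem 4.16 (Hurwitz),
  Chapter VI §3 (3.10) (the arithmetic genus). [Miranda1995]
-/

noncomputable section

open Set Function

namespace Literature.AlgebraicTopology.FundamentalGroup

namespace BranchedCoverPi1Rank

universe u

/-! ### §1 Covering maps: the rank of `π₁` of a connected finite-sheeted cover (Schreier) -/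

section Covering

variable {E X : Type*} [TopologicalSpace E] [TopologicalSpace X] {p : E → X}

/-- **Schreier's index formula for groups free of finite rank, subgroup form**: a subgroup of index `d`
of a group `G ≅ F_n` is `≅ F_r` with `r + d = d·n + 1`. [cite: LyndonSchupp2001, Ch. I Prop. 3.9] -/
theorem exists_mulEquiv_freeGroup_of_index_eq {G : Type u} [Group G] {n d : ℕ}
    (e : G ≃* FreeGroup (Fin n)) (H : Subgroup G) (hH : H.index = d) (hd : d ≠ 0) :
    ∃ r, r + d = d * n + 1 ∧ Nonempty (H ≃* FreeGroup (Fin r)) := by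
  -- transport `H` into `FreeGroup (Fin n)`
  set H' : Subgroup (FreeGroup (Fin n)) := H.map (e : G →* FreeGroup (Fin n)) with hH'
  have hidx : H'.index = d := by rw [hH', Subgroup.index_map_equiv]; exact hH
  haveI : H'.FiniteIndex := ⟨by rw [hidx]; exact hd⟩
  obtain ⟨ι, b, hfin, hcard⟩ := FreeGroup.exists_freeGroupBasis_of_finiteIndex H'
  haveI := hfin
  refine ⟨Nat.card ι, ?_, ⟨((e.subgroupMap H).trans b.repr).trans
    (FreeGroup.freeGroupCongr (Finite.equivFin ι))⟩⟩
  rw [hidx, show Nat.card (Fin n) = n by simp] at hcard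
  exact hcard

/-- **The rank of `π₁` of a connected covering space with `d` sheets over a space with `π₁ ≅ F_n` is
`r` with `r + d = d·n + 1`**: `p_*` is injective (Hatcher Prop. 1.31), its image has index `d` = the
number of sheets (Prop. 1.32), and Schreier's index formula gives the rank.
[cite: HatcherAT2002, Prop. 1.32 with Thm. 1A.4; LyndonSchupp2001, Ch. I Prop. 3.9] -/
theorem exists_mulEquiv_freeGroup_of_isCoveringMap [PathConnectedSpace E] (cov : IsCoveringMap p)
    (e : E) {n d : ℕ} (hd : Nat.card (p ⁻¹' {p e}) = d) (hd0 : d ≠ 0)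
    (hX : Nonempty (_root_.FundamentalGroup X (p e) ≃* FreeGroup (Fin n))) :
    ∃ r, r + d = d * n + 1 ∧ Nonempty (_root_.FundamentalGroup E e ≃* FreeGroup (Fin r)) := by
  obtain ⟨φ⟩ := hX
  set f := _root_.FundamentalGroup.mapOfEq (⟨p, cov.continuous⟩ : C(E, X)) (rfl : p e = p e) with hf
  have hinj : Function.Injective f := BranchedCoverFreePi1.injective_mapOfEq cov e
  have hidx : f.range.index = d := by
    rw [hf, ← hd]
    exact Literature.Topology.CoveringSpaces.CoverMonodromy.index_range_mapOfEq_eq_natCard_fiber cov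
      ⟨e, rfl⟩
  obtain ⟨r, hr, ⟨ψ⟩⟩ := exists_mulEquiv_freeGroup_of_index_eq φ f.range hidx hd0
  exact ⟨r, hr, ⟨(MonoidHom.ofInjective hinj).trans ψ⟩⟩

end Covering

/-! ### §2 The sphere minus a finite set containing `∞` -/

section Sphere

open OnePoint

/-- `|B ∖ {∞}| + 1 = |B|` read through `ℂ ↪ ℂ ∪ {∞}`: `|coe⁻¹(B)| + 1 = |B|` for `B ∋ ∞` finite. [folklore] -/
private theorem ncard_preimage_coe_add_one {B : Set (OnePoint ℂ)} (hBf : B.Finite) (hB : ∞ ∈ B) :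
    (((↑) : ℂ → OnePoint ℂ) ⁻¹' B).ncard + 1 = B.ncard := by
  have h1 : (((↑) : ℂ → OnePoint ℂ) ⁻¹' B).ncard = (B \ {∞}).ncard := by
    rw [← Set.ncard_image_of_injective _ coe_injective]
    congr 1
    ext y
    simp only [mem_image, mem_preimage, mem_sdiff, mem_singleton_iff]
    constructor
    · rintro ⟨z, hz, rfl⟩
      exact ⟨hz, coe_ne_infty z⟩
    · rintro ⟨hy, hy'⟩
      obtain ⟨z, rfl⟩ := ne_infty_iff_exists.1 hy'
      exact ⟨z, hy, rfl⟩
  rw [h1, Set.ncard_sdiff_singleton_add_one hB hBf]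

/-- **`π₁((ℂ ∪ {∞}) ∖ B, y) ≅ F_b` with `b + 1 = |B|`** for `B` finite containing `∞` (it is the plane minus
`|B| − 1` points). [cite: HatcherAT2002, §1.2 Example 1.22] -/
theorem exists_mulEquiv_freeGroup_sphere_compl {B : Set (OnePoint ℂ)} (hBf : B.Finite) (hB : ∞ ∈ B)
    (y : ↥(Bᶜ : Set (OnePoint ℂ))) :
    ∃ b, b + 1 = B.ncard ∧ Nonempty (_root_.FundamentalGroup ↥(Bᶜ : Set (OnePoint ℂ)) y ≃* FreeGroup (Fin b)) := by
  obtain ⟨g⟩ := BranchedCoverFreePi1.nonempty_sphereComplHomeomorph B hBf hB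
  have hF : ((((↑) : ℂ → OnePoint ℂ) ⁻¹' B) : Set ℂ).Finite := hBf.preimage coe_injective.injOn
  obtain ⟨e⟩ := nonempty_mulEquiv_freeGroup_compl_finite hF (g y)
  exact ⟨_, ncard_preimage_coe_add_one hBf hB, ⟨(g.fundamentalGroupMulEquiv rfl).trans e⟩⟩

end Sphere

/-! ### §3 A branched cover of the sphere: `rank π₁(M ∖ F⁻¹(B)) + 1 = 2g + |F⁻¹(B)|` -/

section Branched

open scoped Manifold ContDiff
open Literature.Geometry.Kaehler RiemannSurface

variable {M : Type*} [TopologicalSpace M] [ChartedSpace ℂ M] [IsManifold 𝓘(ℂ, ℂ) ω M]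
  [CompactSpace M] [T2Space M] [ConnectedSpace M]

omit [T2Space M] in
/-- Counting a fibre with multiplicities: `|F⁻¹(Q)| + B_F(Q) = m` where
`B_F(Q) = Σ_{P ∈ F⁻¹(Q)} (mult_P(F) − 1)` and `m = deg F`. [cite: FarkasKra1992, §I.1.6 Proposition] -/
theorem ncard_preimage_singleton_add_branchDiv {N : Type*} [TopologicalSpace N] [ChartedSpace ℂ N]
    [IsManifold 𝓘(ℂ, ℂ) ω N] [T2Space N] {F : M → N} (hF : MDifferentiable 𝓘(ℂ, ℂ) 𝓘(ℂ, ℂ) F)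
    (hne : ∃ x y, F x ≠ F y) {m : ℕ} (hm : ∀ Q, ∑ᶠ P ∈ F ⁻¹' {Q}, ramificationNumber F P = m) (Q : N) :
    ((F ⁻¹' {Q}).ncard : ℤ) + branchDiv F Q = m := by
  classical
  have hfin := finite_preimage_singleton hF hne Q
  rw [branchDiv_apply hF hne, ← hm Q, finsum_mem_eq_finite_toFinset_sum _ hfin,
    finsum_mem_eq_finite_toFinset_sum _ hfin, Set.ncard_eq_toFinset_card _ hfin, Nat.cast_sum,
    Finset.sum_sub_distrib, Finset.sum_const, nsmul_eq_mul, mul_one]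
  ring

omit [T2Space M] in
/-- Off the branch values the branch divisor vanishes. [cite: Miranda1995, Chapter V Definition 1.18] -/
theorem branchDiv_eq_zero_of_forall {N : Type*} [TopologicalSpace N] [ChartedSpace ℂ N]
    [IsManifold 𝓘(ℂ, ℂ) ω N] [T2Space N] {F : M → N} (hF : MDifferentiable 𝓘(ℂ, ℂ) 𝓘(ℂ, ℂ) F)
    (hne : ∃ x y, F x ≠ F y) {Q : N} (hQ : ∀ P, F P = Q → ramificationNumber F P = 1) :
    branchDiv F Q = 0 := by
  rw [branchDiv_apply hF hne]
  refine finsum_mem_eq_zero_of_forall_eq_zero fun P hP ↦ ?_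
  rw [hQ P hP, Nat.cast_one, sub_self]

omit [T2Space M] in
/-- **Counting `F⁻¹(B)` with multiplicities**: for `B` finite containing all branch values,
`|F⁻¹(B)| + deg R_F = deg(F) · |B|`. [cite: FarkasKra1992, §I.1.6 Proposition; Miranda1995, Chapter V Definition 1.18] -/
theorem ncard_preimage_add_degree_ramificationDiv {N : Type*} [TopologicalSpace N] [ChartedSpace ℂ N]
    [IsManifold 𝓘(ℂ, ℂ) ω N] [T2Space N] {F : M → N} (hF : MDifferentiable 𝓘(ℂ, ℂ) 𝓘(ℂ, ℂ) F)
    (hne : ∃ x y, F x ≠ F y) {m : ℕ} (hm : ∀ Q, ∑ᶠ P ∈ F ⁻¹' {Q}, ramificationNumber F P = m)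
    {B : Set N} (hBf : B.Finite) (hB : ∀ Q ∉ B, ∀ P, F P = Q → ramificationNumber F P = 1) :
    ((F ⁻¹' B).ncard : ℤ) + Finsupp.degree (ramificationDiv F) = m * B.ncard := by
  classical
  have hSf : (F ⁻¹' B).Finite := hBf.preimage' fun b _ => finite_preimage_singleton hF hne b
  -- `|F⁻¹(B)| = Σ_{Q ∈ B} |F⁻¹(Q)|`
  have h1 : (F ⁻¹' B).ncard = ∑ Q ∈ hBf.toFinset, (F ⁻¹' {Q}).ncard := by
    rw [Set.ncard_eq_toFinset_card _ hSf,
      Finset.card_eq_sum_card_fiberwise (f := F) (t := hBf.toFinset)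
        (fun x hx => by
          rw [Finset.mem_coe, Set.Finite.mem_toFinset] at hx
          exact hBf.mem_toFinset.2 hx)]
    refine Finset.sum_congr rfl fun Q hQ => ?_
    rw [Set.ncard_eq_toFinset_card _ (finite_preimage_singleton hF hne Q)]
    congr 1
    ext P
    simp only [Finset.mem_filter, Set.Finite.mem_toFinset, mem_preimage, mem_singleton_iff,
      and_iff_right_iff_imp]
    intro h
    rw [h]
    exact hBf.mem_toFinset.1 hQ
  -- `deg R_F = deg B_F = Σ_{Q ∈ B} B_F(Q)` (the branch divisor is supported on `B`)
  have h2 : Finsupp.degree (ramificationDiv F) = ∑ Q ∈ hBf.toFinset, branchDiv F Q := by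
    rw [← degree_branchDiv, Finsupp.degree_apply]
    refine Finset.sum_subset (fun Q hQ => ?_) (fun Q _ hQ => Finsupp.notMem_support_iff.1 hQ)
    rw [Set.Finite.mem_toFinset]
    by_contra hQB
    exact (Finsupp.mem_support_iff.1 hQ) (branchDiv_eq_zero_of_forall hF hne (hB Q hQB))
  rw [h1, h2, Nat.cast_sum, ← Finset.sum_add_distrib,
    Finset.sum_congr rfl fun Q _ => ncard_preimage_singleton_add_branchDiv hF hne hm Q,
    Finset.sum_const, nsmul_eq_mul, Set.ncard_eq_toFinset_card _ hBf]
  ring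

/-- **A branched cover of the sphere computes the rank**: for a non-constant holomorphic
`F : M → ℂ ∪ {∞}` on a compact connected Riemann surface and `S' = F⁻¹(branch values ∪ {∞, F x₀})`,
`π₁(M ∖ S', z) ≅ F_r` with **`r + 1 = 2g + |S'|`**, `g = arithGenus M` (`M ∖ S'` is a `deg F`-sheeted
connected covering of the sphere minus `|B|` points: Schreier's index formula, the fibre count
`|S'| + deg R_F = deg F · |B|` and Hurwitz's formula `2g − 2 = deg R_F − 2 deg F`).
[cite: Massey1967AlgebraicTopology, Ch. 4 §5; HatcherAT2002, Prop. 1.32, Thm. 1A.4; Miranda1995, Chapter II Theorem 4.16] -/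
theorem exists_finite_compl_mulEquiv_freeGroup {F : M → OnePoint ℂ}
    (hF : MDifferentiable 𝓘(ℂ, ℂ) 𝓘(ℂ, ℂ) F) (hne : ∃ x y, F x ≠ F y) (x₀ : M) :
    ∃ S' : Set M, S'.Finite ∧ x₀ ∈ S' ∧ ∃ r : ℕ, r + 1 = 2 * arithGenus M + S'.ncard ∧
      ∀ z : ↥(S'ᶜ : Set M), Nonempty (_root_.FundamentalGroup ↥(S'ᶜ : Set M) z ≃* FreeGroup (Fin r)) := by
  classical
  -- branch values, `∞` and `F x₀`
  set V₀ : Set (OnePoint ℂ) := {Q | ∀ P, F P = Q → ramificationNumber F P = 1} with hV₀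
  have hcov : IsCoveringMapOn F V₀ := RiemannSurface.isCoveringMapOn hF hne
  set B : Set (OnePoint ℂ) := V₀ᶜ ∪ ({(OnePoint.infty : OnePoint ℂ)} ∪ {F x₀}) with hBdef
  have hBf : B.Finite :=
    (finite_branchValues hF hne).union ((Set.finite_singleton _).union (Set.finite_singleton _))
  have hB : (OnePoint.infty : OnePoint ℂ) ∈ B := Or.inr (Or.inl rfl)
  have hx₀B : F x₀ ∈ B := Or.inr (Or.inr rfl)
  have hVB : Bᶜ ⊆ V₀ := fun Q hQ => by
    by_contra h; exact hQ (Or.inl h)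
  have hBV : ∀ Q ∉ B, ∀ P, F P = Q → ramificationNumber F P = 1 := fun Q hQ => hVB hQ
  have hS'f : (F ⁻¹' B).Finite := hBf.preimage' fun b _ => finite_preimage_singleton hF hne b
  -- the degree `m`, the fibre count and Hurwitz's formula
  obtain ⟨m, hm0, hm⟩ := exists_finsum_ramificationNumber_eq hF hne
  have hcount := ncard_preimage_add_degree_ramificationDiv hF hne hm hBf hBV
  have hRH := two_mul_arithGenus_sub_two_eq_degree_ramificationDiv_sub hF hne hm
  -- a point of `M ∖ F⁻¹(B)` (`M` is infinite)
  haveI : Infinite M := RiemannSurface.infinite_of_chartedSpace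
  obtain ⟨z₀, hz₀⟩ : ∃ z, z ∉ F ⁻¹' B := hS'f.infinite_compl.nonempty
  refine ⟨F ⁻¹' B, hS'f, hx₀B, ?_⟩
  -- the covering `F⁻¹(Bᶜ) → Bᶜ`, with path connected total space `M ∖ F⁻¹(B)`
  have hcovB : IsCoveringMap ((Bᶜ).restrictPreimage F) :=
    (hcov.mono hVB).isCoveringMap_restrictPreimage
  have hpc : IsPathConnected ((F ⁻¹' B)ᶜ : Set M) :=
    PunctureIndependence.isPathConnected_compl_finite hS'f ⟨z₀, hz₀⟩
  haveI : PathConnectedSpace ↥(F ⁻¹' Bᶜ) := isPathConnected_iff_pathConnectedSpace.1 hpc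
  haveI : PathConnectedSpace ↥((F ⁻¹' B)ᶜ : Set M) := isPathConnected_iff_pathConnectedSpace.1 hpc
  set z : ↥(F ⁻¹' Bᶜ) := ⟨z₀, hz₀⟩ with hzdef
  -- rank of the base
  obtain ⟨b, hb, hXb⟩ := exists_mulEquiv_freeGroup_sphere_compl hBf hB ((Bᶜ).restrictPreimage F z)
  -- the fibre has `m` points
  have hfibre : ((Bᶜ).restrictPreimage F) ⁻¹' {(Bᶜ).restrictPreimage F z} =
      Subtype.val ⁻¹' (F ⁻¹' {F z₀}) := by
    ext w
    simp only [mem_preimage, mem_singleton_iff]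
    constructor
    · intro hw; exact congrArg Subtype.val hw
    · intro hw; exact Subtype.ext hw
  have hfib : Nat.card (((Bᶜ).restrictPreimage F) ⁻¹' {(Bᶜ).restrictPreimage F z}) = m := by
    rw [hfibre, Nat.card_coe_set_eq, Set.ncard_preimage_of_injective_subset_range Subtype.val_injective,
      ncard_preimage_singleton_eq_finsum hF hne (hBV (F z₀) hz₀), hm]
    intro w hw
    rw [mem_preimage, mem_singleton_iff] at hw
    refine ⟨⟨w, ?_⟩, rfl⟩
    show w ∉ F ⁻¹' B
    rw [mem_preimage, hw]; exact hz₀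
  obtain ⟨r, hr, hEr⟩ := exists_mulEquiv_freeGroup_of_isCoveringMap hcovB z hfib hm0.ne' hXb
  refine ⟨r, ?_, fun w => ?_⟩
  · -- `r + m = m b + 1`, `b + 1 = |B|`, `|F⁻¹ B| + deg R_F = m |B|`, `2g − 2 = deg R_F − 2m`
    have hr' : (r : ℤ) + m = m * b + 1 := by exact_mod_cast hr
    have hb' : (b : ℤ) + 1 = B.ncard := by exact_mod_cast hb
    have key : (r : ℤ) + 1 = 2 * arithGenus M + (F ⁻¹' B).ncard := by
      linear_combination hr' + (m : ℤ) * hb' - hcount - hRH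
    exact_mod_cast key
  · obtain ⟨e⟩ := hEr
    exact ⟨(_root_.FundamentalGroup.fundamentalGroupMulEquivOfPathConnected w z).trans e⟩

end Branched

end BranchedCoverPi1Rank

/-! ### §4 The rank `2g + |S| − 1` for every finite non-empty puncture set -/

section Rank

open scoped Manifold ContDiff
open Literature.Geometry.Kaehler RiemannSurface

variable {M : Type*} [TopologicalSpace M] [ChartedSpace ℂ M] [IsManifold 𝓘(ℂ, ℂ) ω M]
  [CompactSpace M] [T2Space M] [ConnectedSpace M]

/-- **The fundamental group of a compact Riemann surface of genus `g` with `r ≥ 1` punctures is free of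
rank `2g + r − 1`** (Massey Ch. 4 §5, with `g = arithGenus M`): for `S ⊆ M` finite non-empty and every base
point `x ∈ M ∖ S`, `π₁(M ∖ S, x) ≅ F_{2g + |S| − 1}`. [cite: Massey1967AlgebraicTopology, Ch. 4 §5] -/
theorem nonempty_mulEquiv_freeGroup_compl_of_finite {S : Set M} (hS : S.Finite) (hSne : S.Nonempty)
    (x : ↥(Sᶜ : Set M)) :
    Nonempty (_root_.FundamentalGroup ↥(Sᶜ : Set M) x ≃*
      FreeGroup (Fin (2 * arithGenus M + S.ncard - 1))) := by
  obtain ⟨s, hs⟩ := hSne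
  have hxs : (x : M) ≠ s := fun h => x.2 (h ▸ hs)
  obtain ⟨F, hFmer, hFne⟩ := RiemannSurface.separatesPoints_meromorphicFunctions hxs
  obtain ⟨S', hS'f, hsS', r, hr, hfree⟩ :=
    BranchedCoverPi1Rank.exists_finite_compl_mulEquiv_freeGroup hFmer.1 ⟨_, _, hFne⟩ s
  haveI : Infinite M := RiemannSurface.infinite_of_chartedSpace
  obtain ⟨y, hy⟩ : ∃ y, y ∉ S' := hS'f.infinite_compl.nonempty
  obtain ⟨n, hn, hrank⟩ := exists_mulEquiv_freeGroup_compl_of_compl hS ⟨s, hs⟩ hS'f ⟨s, hsS'⟩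
    ⟨y, hy⟩ (hfree ⟨y, hy⟩)
  obtain rfl : n = 2 * arithGenus M + S.ncard - 1 := by omega
  exact hrank x

/-- `HasFreePiRank` form: `π₁(M ∖ S)` is free of rank `2g + |S| − 1` at every base point.
[cite: Massey1967AlgebraicTopology, Ch. 4 §5] -/
theorem hasFreePiRank_of_finite {S : Set M} (hS : S.Finite) (hSne : S.Nonempty) :
    HasFreePiRank S (2 * arithGenus M + S.ncard - 1) :=
  fun x => nonempty_mulEquiv_freeGroup_compl_of_finite hS hSne x

/-- The rank in additive form: `π₁(M ∖ S, x) ≅ F_n` with `n + 1 = 2g + |S|`. [cite: Massey1967AlgebraicTopology, Ch. 4 §5] -/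
theorem exists_mulEquiv_freeGroup_compl_of_finite {S : Set M} (hS : S.Finite) (hSne : S.Nonempty)
    (x : ↥(Sᶜ : Set M)) :
    ∃ n, n + 1 = 2 * arithGenus M + S.ncard ∧
      Nonempty (_root_.FundamentalGroup ↥(Sᶜ : Set M) x ≃* FreeGroup (Fin n)) := by
  refine ⟨2 * arithGenus M + S.ncard - 1, ?_, nonempty_mulEquiv_freeGroup_compl_of_finite hS hSne x⟩
  have : 0 < S.ncard := (Set.ncard_pos hS).2 hSne
  omega

/-- **The rank is `2g + |S| − 1` and no other**: if `π₁(M ∖ S, x) ≅ F_n` then `n + 1 = 2g + |S|`.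
[cite: Massey1967AlgebraicTopology, Ch. 4 §5] -/
theorem eq_of_mulEquiv_freeGroup_compl {S : Set M} (hS : S.Finite) (hSne : S.Nonempty)
    {x : ↥(Sᶜ : Set M)} {n : ℕ} (e : _root_.FundamentalGroup ↥(Sᶜ : Set M) x ≃* FreeGroup (Fin n)) :
    n + 1 = 2 * arithGenus M + S.ncard := by
  obtain ⟨n', hn', ⟨e'⟩⟩ := exists_mulEquiv_freeGroup_compl_of_finite hS hSne x
  rw [eq_of_mulEquiv_freeGroup_fin e e']
  exact hn'

/-- **One puncture: `π₁(M ∖ {p}, x) ≅ F_{2g}`.** [cite: Massey1967AlgebraicTopology, Ch. 4 §5] -/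
theorem nonempty_mulEquiv_freeGroup_compl_singleton (p : M) (x : ↥(({p} : Set M)ᶜ)) :
    Nonempty (_root_.FundamentalGroup ↥(({p} : Set M)ᶜ) x ≃* FreeGroup (Fin (2 * arithGenus M))) := by
  have h := nonempty_mulEquiv_freeGroup_compl_of_finite (Set.finite_singleton p)
    (Set.singleton_nonempty p) x
  rwa [Set.ncard_singleton, Nat.add_sub_cancel] at h

/-- **`r` punctures given as a `Finset`: `π₁(M ∖ S, x) ≅ F_{2g + |S| − 1}`.** [cite: Massey1967AlgebraicTopology, Ch. 4 §5] -/
theorem nonempty_mulEquiv_freeGroup_compl_finset (S : Finset M) (hS : S.Nonempty)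
    (x : ↥((S : Set M)ᶜ)) :
    Nonempty (_root_.FundamentalGroup ↥((S : Set M)ᶜ) x ≃*
      FreeGroup (Fin (2 * arithGenus M + S.card - 1))) := by
  have h := nonempty_mulEquiv_freeGroup_compl_of_finite S.finite_toSet hS x
  rwa [Set.ncard_coe_finset] at h

/-- The genus from the rank: if `π₁(M ∖ {p}, x) ≅ F_n` then `n = 2g`. [cite: Massey1967AlgebraicTopology, Ch. 4 §5] -/
theorem two_mul_arithGenus_eq_of_mulEquiv_freeGroup_compl_singleton {p : M} {x : ↥(({p} : Set M)ᶜ)}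
    {n : ℕ} (e : _root_.FundamentalGroup ↥(({p} : Set M)ᶜ) x ≃* FreeGroup (Fin n)) :
    2 * arithGenus M = n := by
  have h := eq_of_mulEquiv_freeGroup_compl (Set.finite_singleton p) (Set.singleton_nonempty p) e
  rw [Set.ncard_singleton] at h
  omega

end Rank

end Literature.AlgebraicTopology.FundamentalGroup

end
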